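import Literature.Barriers.ValiantsHypothesis.CT23ExplicitAnnihilatorCircuit
import Literature.Barriers.ValiantsHypothesis.CT23SuccinctDeterminant
import Literature.Barriers.ValiantsHypothesis.CT23EncoderSpecialisation
import HarnessLib

/-!
# `CT23_thm_3_1` holds — Chatterjee–Tengse, *Lower Bounds from Succinct Hitting Sets*
# (arXiv:2309.07612v2), Thm. 3.1 "Annihilators of explicit maps", assembled from the X-CT23
# engine bricks (val-lit cell; t18 g8, brick E-f, closer A)

Theorem-only file (no definitions, NO named facts): the discharge
`CT23_thm_3_1_holds : CT23_thm_3_1` of the named fact of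
`CT23LowerBoundsFromSuccinctHittingSets.lean`, following the printed §3.3 "Completing the proof"
(v1 p0016.txt:L10–L22) on top of the cell's bricks:

1. **restrict to the first `2m` outputs** `G' = G ∘ castLE` ("Let `G' = (g_1(z), …, g_{2m}(z))`,
   the first `2m` co-ordinates. Clearly, `C_G` encodes `G'` as well");
2. **front end** (t20 g9, bricks E-n + `CT23EncoderSpecialisation`): the encoder `Q` of the fact
   — ANY fan-in-two projection circuit computing `U(z, y)` with `U(z, c_t) = g_t` (Def. 1.7),
   possibly projecting its own inputs — is normalised (input normalisation, the printed-proof gap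
   B43 closed in the kernel) and specialised into `2m` input-free copies `Q_t` computing `g_t`,
   each of size `≤ 17s + 5` over one common workspace (`ProjCircuit.exists_specialised_inputFree`);
3. **Lemma 3.2 with explicit prefix columns** (p2 g8, `CT23AnnihilatorPrefixColumns`): block
   width `δ` with `2^δ ≤ 3md < 2^{δ+1}` (`exists_blockWidth`), the total-degree count
   (`count_of_param`, `m ≥ 2`), the minimal dependent prefix `K = prefixLen` of the powers
   `G'^e` along the bit-block enumeration of `[2^δ]^{2m}`, a good `α` for the Kronecker rows
   (`exists_kronMinor_det_ne_zero`), and the annihilator `A = det M̃` (`prefixAnnMatrix`):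
   `A ≠ 0`, `deg_{x_t} A < 2^δ ≤ 3md`, `A ∘ G' = 0`;
4. **Lemma 3.5** (p2 g8, `CT23ExplicitAnnihilatorEncoder` / `…Circuit`): the explicit encoder
   circuit `C` of the padded `2^{2mδ} × 2^{2mδ}` matrix `M̃` from the copies `Q_t`
   (`CT23Encoder.exists_encoderCircuit`, `det_matOf_encoderSkeleton_prefix`), all variable blocks
   laid out disjointly in ONE workspace `Fin T` next to the annihilator variables
   `x = Sum.inl ∘ castLE` (one `Fintype.equivFin` of a sum type);
5. **Prop. 2.29** (t24, `CT23SuccinctDeterminant`, general form): the determinant of the encoded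
   matrix by a projection circuit of size `≤ 2·|C| + O(L²)`, `L = 2mδ` (Mahajan–Vinay program,
   repeated squaring with one copy of the encoder per level — bricks E-c/E-c′/E-d);
6. numerics: `t, size ≤ (m·d·s)^{13}` for `m ≥ 2 = m₀`, `d ≥ 1`, `s ≥ 2`
   (`ProjCircuit.mul_frontEnd_pow_le`-style bookkeeping, `skelBound (2m) δ ≤ 3300 (md)^6`).
   SIZE-BOUND NOTE (cell record (483)): FILE 3's `size_encCircuit_le` / `skelBound` carry a `2^δ`
   term (naive power bound; print `(nd)³`); here `δ` IS the block width of the parameter lemma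
   (`exists_blockWidth`: `2^δ ≤ 3md`), so `2^δ` is polynomial and the total is `≤ (mds)^{13}` —
   a disclosed looser-than-print POLYNOMIAL bound (print: `(m·d·s)^4`, v1 p0016.txt:L24), inside
   the fact's `∃ c`.

Honest framing: Thm. 3.1 is a 2023 published upper bound on annihilators (consequences-side
literature for the natural-proofs barrier programme); its formalisation here follows the printed
construction with the disclosed deviations of the bricks (power-of-two box side via the
total-degree count; identity padding of `M̃`; input normalisation of the encoder). `VP ≠ VNP` is
NOT proved and nothing here bears on it.

## References

* [ChatterjeeTengse2023] P. Chatterjee, A. Tengse, *Lower Bounds from Succinct Hitting Sets*,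
  arXiv:2309.07612v2, Thm. 3.1 and §3.3 (v1: Theorem "Annihilators of explicit maps", §3;
  held text `paper:arxiv-2309.07612` p0014.txt:L6–L10, p0016.txt:L10–L22), Lemma 3.2, Lemma 3.5,
  Prop. 2.29.
-/

noncomputable section

open MvPolynomial

namespace Literature.Barriers.ValiantsHypothesis

open Literature.Computability.AlgebraicComplexity CT23Encoder

universe u

/-! ### Numerics of §3.3 -/

namespace CT23Thm31

/-- `δ < 2^δ`. [folklore] -/
private theorem lt_two_pow_self' (δ : ℕ) : δ < 2 ^ δ := Nat.lt_two_pow_self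

/-- The skeleton bound of Lemma 3.5 at the parameters of Thm. 3.1 is `≤ 3300 (m d)^6`
(`2^δ ≤ 3md`). [cite: ChatterjeeTengse2023, §3.3 size count (v1: p0016.txt:L18–L20)] -/
private theorem skelBound_le {m d δ : ℕ} (hm : 1 ≤ m) (hd : 1 ≤ d) (hδ : 2 ^ δ ≤ 3 * m * d) :
    skelBound (2 * m) δ ≤ 3300 * (m * d) ^ 6 := by
  set Y := m * d with hY
  have hY1 : 1 ≤ Y := by rw [hY]; exact Nat.one_le_iff_ne_zero.2 (Nat.mul_ne_zero (by omega) (by omega))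
  have hδY : δ ≤ 3 * Y := by
    have := lt_two_pow_self' δ
    rw [hY]; calc δ ≤ 2 ^ δ := this.le
      _ ≤ 3 * m * d := hδ
      _ = 3 * (m * d) := by ring
  have h2δ : 2 ^ δ ≤ 3 * Y := by rw [hY]; calc 2 ^ δ ≤ 3 * m * d := hδ
    _ = 3 * (m * d) := by ring
  have hmY : m ≤ Y := by rw [hY]; exact Nat.le_mul_of_pos_right m (by omega)
  have hL : 2 * m * δ ≤ 6 * Y ^ 2 := by
    calc 2 * m * δ ≤ 2 * Y * (3 * Y) := by gcongr
      _ = 6 * Y ^ 2 := by ring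
  have hY12 : Y ≤ Y ^ 2 := by nlinarith
  have hY24 : Y ^ 2 ≤ Y ^ 4 := Nat.pow_le_pow_right hY1 (by norm_num)
  have hY25 : Y ^ 2 ≤ Y ^ 5 := Nat.pow_le_pow_right hY1 (by norm_num)
  have hY46 : Y ^ 4 ≤ Y ^ 6 := Nat.pow_le_pow_right hY1 (by norm_num)
  have hY15 : Y ≤ Y ^ 5 := hY12.trans hY25
  have hY16 : Y ≤ Y ^ 6 := hY12.trans (hY24.trans hY46)
  have hY26 : Y ^ 2 ≤ Y ^ 6 := hY24.trans hY46
  have h16 : 1 ≤ Y ^ 6 := Nat.one_le_pow _ _ hY1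
  have h14 : 1 ≤ Y ^ 4 := Nat.one_le_pow _ _ hY1
  set L := 2 * m * δ with hLdef
  have hcLT : L * (L * 8 + 5) ≤ 318 * Y ^ 4 := by
    calc L * (L * 8 + 5) ≤ (6 * Y ^ 2) * ((6 * Y ^ 2) * 8 + 5) := by gcongr
      _ = 288 * Y ^ 4 + 30 * Y ^ 2 := by ring
      _ ≤ 288 * Y ^ 4 + 30 * Y ^ 4 := by gcongr
      _ = 318 * Y ^ 4 := by ring
  have hcRow : L * (L * 8 + 5) + 8 * L + 3 ≤ 369 * Y ^ 4 := by
    have h1 : L * (L * 8 + 5) + 8 * L + 3 ≤ 318 * Y ^ 4 + 8 * (6 * Y ^ 2) + 3 := by gcongr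
    have h2 : 8 * (6 * Y ^ 2) ≤ 48 * Y ^ 4 := by nlinarith [hY24]
    omega
  have hinner : δ * (L * (L * 8 + 5) + 8 * L + 3 + 2 ^ δ + 4) + δ ≤ 1131 * Y ^ 5 := by
    calc δ * (L * (L * 8 + 5) + 8 * L + 3 + 2 ^ δ + 4) + δ
        ≤ (3 * Y) * (369 * Y ^ 4 + 3 * Y + 4) + 3 * Y := by gcongr
      _ = 1107 * Y ^ 5 + 9 * Y ^ 2 + 15 * Y := by ring
      _ ≤ 1107 * Y ^ 5 + 9 * Y ^ 5 + 15 * Y ^ 5 := by gcongr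
      _ = 1131 * Y ^ 5 := by ring
  change 2 * (L * (L * 8 + 5) + 2) +
        (2 * m * (δ * (L * (L * 8 + 5) + 8 * L + 3 + 2 ^ δ + 4) + δ) + 2 * m) +
        (L * (L * 8 + 5) + 4 + 8 * L + 1) + 4 ≤ _
  have h3 : 2 * m * (δ * (L * (L * 8 + 5) + 8 * L + 3 + 2 ^ δ + 4) + δ) + 2 * m ≤
      2 * Y * (1131 * Y ^ 5) + 2 * Y := by gcongr
  have h4 : 2 * Y * (1131 * Y ^ 5) = 2262 * Y ^ 6 := by ring
  have h5 : 8 * L ≤ 48 * Y ^ 6 := by nlinarith [hL, hY26]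
  nlinarith [hcLT, h3, h4, h5, hY46, hY16, h16]

/-- The size count of §3.3: `2·|C| + O(L²) ≤ (mds)^{13}` with `|C| ≤ 2m(17s+5) + m(10mδ+1) +
skelBound` ("`O((2md)³ + 4m·size(C_G) + log² K) = (m·d·s)^4`" in print, up to our bookkeeping
constants). [cite: ChatterjeeTengse2023, §3.3 (v1: p0016.txt:L18–L20)] -/
private theorem size_le {m d s δ : ℕ} (hm : 2 ≤ m) (hd : 1 ≤ d) (hs : 2 ≤ s)
    (hδ : 2 ^ δ ≤ 3 * m * d) :
    2 * (2 * m * (17 * s + 5) + (m * (5 * (2 * m * δ) + 1) + skelBound (2 * m) δ)) +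
      (145 * (2 * m * δ) ^ 2 + 256 * (2 * m * δ) + 49) ≤ (m * d * s) ^ 13 := by
  have hsk := skelBound_le (by omega) hd hδ
  set X := m * d * s with hX
  have hY : m * d ≤ X := by rw [hX]; exact Nat.le_mul_of_pos_right _ (by omega)
  have hmX : m ≤ X := le_trans (Nat.le_mul_of_pos_right m (by omega)) hY
  have hsX : s ≤ X := by
    rw [hX]; calc s = 1 * s := (one_mul s).symm
      _ ≤ (m * d) * s := by gcongr; exact Nat.one_le_iff_ne_zero.2 (Nat.mul_ne_zero (by omega) (by omega))
  have hX4 : 4 ≤ X := by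
    rw [hX]; calc 4 = 2 * 1 * 2 := by norm_num
      _ ≤ m * d * s := by gcongr
  have hδX : δ ≤ 3 * X := by
    calc δ ≤ 2 ^ δ := (lt_two_pow_self' δ).le
      _ ≤ 3 * m * d := hδ
      _ = 3 * (m * d) := by ring
      _ ≤ 3 * X := by gcongr
  have hL : 2 * m * δ ≤ 6 * X ^ 2 := by
    calc 2 * m * δ ≤ 2 * X * (3 * X) := by gcongr
      _ = 6 * X ^ 2 := by ring
  have h1 : 2 * m * (17 * s + 5) ≤ 44 * X ^ 2 := by
    calc 2 * m * (17 * s + 5) ≤ 2 * X * (17 * X + 5 * X) := by gcongr; omega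
      _ = 44 * X ^ 2 := by ring
  have h2 : m * (5 * (2 * m * δ) + 1) ≤ 31 * X ^ 3 := by
    calc m * (5 * (2 * m * δ) + 1) ≤ X * (5 * (6 * X ^ 2) + X ^ 2) := by
          gcongr; nlinarith
      _ = 31 * X ^ 3 := by ring
  have h3 : skelBound (2 * m) δ ≤ 3300 * X ^ 6 :=
    hsk.trans (Nat.mul_le_mul_left _ (Nat.pow_le_pow_left hY 6))
  have h4 : (2 * m * δ) ^ 2 ≤ 36 * X ^ 4 := by
    calc (2 * m * δ) ^ 2 ≤ (6 * X ^ 2) ^ 2 := Nat.pow_le_pow_left hL 2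
      _ = 36 * X ^ 4 := by ring
  have hX1 : 1 ≤ X := by omega
  have e26 : X ^ 2 ≤ X ^ 6 := Nat.pow_le_pow_right hX1 (by norm_num)
  have e36 : X ^ 3 ≤ X ^ 6 := Nat.pow_le_pow_right hX1 (by norm_num)
  have e46 : X ^ 4 ≤ X ^ 6 := Nat.pow_le_pow_right hX1 (by norm_num)
  have e06 : 1 ≤ X ^ 6 := Nat.one_le_pow _ _ hX1
  have htot : 2 * (2 * m * (17 * s + 5) + (m * (5 * (2 * m * δ) + 1) + skelBound (2 * m) δ)) +
      (145 * (2 * m * δ) ^ 2 + 256 * (2 * m * δ) + 49) ≤ 13555 * X ^ 6 := by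
    nlinarith [h1, h2, h3, h4, hL, e26, e36, e46, e06]
  refine htot.trans ?_
  calc 13555 * X ^ 6 ≤ 4 ^ 7 * X ^ 6 := by gcongr; norm_num
    _ ≤ X ^ 7 * X ^ 6 := by gcongr
    _ = X ^ 13 := by ring

/-- The workspace count: all the variable blocks fit into `(mds)^{13}` workspace variables.
[cite: ChatterjeeTengse2023, §3.3 (v1: p0016.txt:L18–L20)] -/
private theorem workspace_le {m d s δ t₀ : ℕ} (hm : 2 ≤ m) (hd : 1 ≤ d) (hs : 2 ≤ s)
    (hδ : 2 ^ δ ≤ 3 * m * d) (ht₀ : t₀ ≤ 9 * s + 4) :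
    2 * m * δ + 2 * m * δ + (2 * m + t₀) +
      (3 * (2 * m * δ) + 3 * (2 * m * δ) + (2 * m * δ * (3 * (2 * m * δ)) + 2 * m * δ) + (2 + 1))
      ≤ (m * d * s) ^ 13 := by
  set X := m * d * s with hX
  have hY : m * d ≤ X := by rw [hX]; exact Nat.le_mul_of_pos_right _ (by omega)
  have hmX : m ≤ X := le_trans (Nat.le_mul_of_pos_right m (by omega)) hY
  have hsX : s ≤ X := by
    rw [hX]; calc s = 1 * s := (one_mul s).symm
      _ ≤ (m * d) * s := by gcongr; exact Nat.one_le_iff_ne_zero.2 (Nat.mul_ne_zero (by omega) (by omega))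
  have hX4 : 4 ≤ X := by
    rw [hX]; calc 4 = 2 * 1 * 2 := by norm_num
      _ ≤ m * d * s := by gcongr
  have hδX : δ ≤ 3 * X := by
    calc δ ≤ 2 ^ δ := (lt_two_pow_self' δ).le
      _ ≤ 3 * m * d := hδ
      _ = 3 * (m * d) := by ring
      _ ≤ 3 * X := by gcongr
  have hL : 2 * m * δ ≤ 6 * X ^ 2 := by
    calc 2 * m * δ ≤ 2 * X * (3 * X) := by gcongr
      _ = 6 * X ^ 2 := by ring
  have hX1 : 1 ≤ X := by omega
  have e24 : X ^ 2 ≤ X ^ 4 := Nat.pow_le_pow_right hX1 (by norm_num)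
  have e14 : X ≤ X ^ 4 := le_trans (by nlinarith) e24
  have e04 : 1 ≤ X ^ 4 := Nat.one_le_pow _ _ hX1
  have hsq : (2 * m * δ) * (3 * (2 * m * δ)) ≤ 108 * X ^ 4 := by
    calc (2 * m * δ) * (3 * (2 * m * δ)) ≤ (6 * X ^ 2) * (3 * (6 * X ^ 2)) := by gcongr
      _ = 108 * X ^ 4 := by ring
  have htot : 2 * m * δ + 2 * m * δ + (2 * m + t₀) +
      (3 * (2 * m * δ) + 3 * (2 * m * δ) + (2 * m * δ * (3 * (2 * m * δ)) + 2 * m * δ) + (2 + 1))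
      ≤ 200 * X ^ 4 := by nlinarith [hL, hsq, hmX, hsX, ht₀, e24, e14, e04]
  refine htot.trans ?_
  calc 200 * X ^ 4 ≤ 4 ^ 4 * X ^ 4 := by gcongr; norm_num
    _ ≤ X ^ 4 * X ^ 4 := by gcongr
    _ ≤ X ^ 13 := by rw [← pow_add]; exact Nat.pow_le_pow_right hX1 (by norm_num)

/-- The block width is positive: `3md ≥ 6 > 2` forces `δ ≥ 1`. [cite: ChatterjeeTengse2023, §3.3 (v1: p0016.txt:L14–L16)] -/
private theorem blockWidth_pos {m d δ : ℕ} (hm : 2 ≤ m) (hd : 1 ≤ d) (hδ : 3 * m * d < 2 * 2 ^ δ) :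
    0 < δ := by
  rcases Nat.eq_zero_or_pos δ with h | h
  · subst h
    have : 6 ≤ 3 * m * d := by nlinarith
    simp at hδ
    omega
  · exact h

end CT23Thm31

open CT23Thm31 in
/-- **Chatterjee–Tengse Thm. 3.1 holds** (discharge of the named fact `CT23_thm_3_1`, with
`c = 13`, `m₀ = 2`). See the module docstring for the assembly; the constants: block width `δ`
with `2^δ ≤ 3md < 2^{δ+1}`, `L = 2mδ` index bits, `K + 1 ≤ 2^L` prefix columns, Kronecker base
`Δ = 2m(2^δ−1)d + 1`, `L` squaring levels; individual degree `< 2^δ ≤ 3md`.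
[cite: ChatterjeeTengse2023, Thm. 3.1 and §3.3 (v1: §3 Theorem "Annihilators of explicit maps"; p0014.txt:L6–L10, p0016.txt:L10–L22)] -/
theorem CT23_thm_3_1_holds : CT23_thm_3_1 := by
  intro F _ _
  refine ⟨13, 2, ?_⟩
  intro m n d s r w G U Q hm h2m hd hs hG h2 hU hsz hEnc
  classical
  -- (1) the first `2m` outputs
  set G' : Fin (2 * m) → MvPolynomial (Fin m) F := fun i => G (Fin.castLE h2m i) with hG'def
  have hG' : ∀ i, (G' i).totalDegree ≤ d := fun i => hG _
  have hEnc' : Encodes U G' := fun i => hEnc _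
  -- (2) front end: `2m` input-free specialised copies of the encoder
  obtain ⟨t₀, Qs, ht₀, hQs⟩ := ProjCircuit.exists_specialised_inputFree U G' Q h2 hU hEnc'
  have hQs2 : ∀ t, (Qs t).IsFanInTwo := fun t => (hQs t).1
  have hQsc : ∀ t, (Qs t).Computes (rename Sum.inl (G' t)) := fun t => (hQs t).2.1
  have hQss : ∀ t, (Qs t).size ≤ 17 * s + 5 := fun t =>
    (hQs t).2.2.1.trans (by have := hsz; omega)
  have hQsp : ∀ t, (Qs t).projVars ⊆ Set.range Sum.inr := fun t => (hQs t).2.2.2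
  -- (3) Lemma 3.2 with prefix columns
  obtain ⟨δ, hδle, hδlt⟩ := exists_blockWidth (show 1 ≤ m by omega) hd
  have hδpos : 0 < δ := blockWidth_pos hm hd hδlt
  have hcount := count_of_param hm hd hδlt
  have hdep := not_linearIndependent_blockEnum G' hG' hcount
  have hK : prefixLen G' (blockEnum (2 * m) δ) hdep + 1 ≤ 2 ^ (2 * m * δ) :=
    prefixLen_succ_le _ _ _
  obtain ⟨α, hα⟩ := exists_kronMinor_det_ne_zero G' (blockEnum (2 * m) δ) hdep (box_blockEnum G' hG')
  set A : MvPolynomial (Fin (2 * m)) F :=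
    (prefixAnnMatrix G' (blockEnum (2 * m) δ) hdep (2 * m * (2 ^ δ - 1) * d + 1) α).det with hAdef
  have hA0 : A ≠ 0 :=
    det_prefixAnnMatrix_ne_zero G' _ (blockEnum_injective _ _) hdep _ hα
  have hAdeg : ∀ t, A.degreeOf t < 2 ^ δ := fun t =>
    degreeOf_det_prefixAnnMatrix_lt G' _ hdep (by positivity) (fun j t => blockEnum_lt _ _ j t) _ α t
  have hAG : aeval G' A = 0 := aeval_det_prefixAnnMatrix G' _ hdep _ α
  -- (4) ONE layout of all the variable blocks in the workspace `Fin T`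
  let Ω : Type :=
    ((Fin (2 * m * δ) ⊕ Fin (2 * m * δ)) ⊕ (Fin (2 * m) ⊕ Fin t₀)) ⊕
      (((Fin (3 * (2 * m * δ)) ⊕ Fin (3 * (2 * m * δ))) ⊕
          ((Fin (2 * m * δ) × Fin (3 * (2 * m * δ))) ⊕ Fin (2 * m * δ))) ⊕ (Bool ⊕ Unit))
  let eΩ : Ω ≃ Fin (Fintype.card Ω) := Fintype.equivFin Ω
  let emb : Ω → Fin n ⊕ Fin (Fintype.card Ω) := fun o => Sum.inr (eΩ o)
  have hemb : Function.Injective emb := fun o o' h => eΩ.injective (Sum.inr_injective h)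
  let x : Fin (2 * m) → Fin n ⊕ Fin (Fintype.card Ω) := fun t => Sum.inl (Fin.castLE h2m t)
  let a : Fin (2 * m * δ) → Fin n ⊕ Fin (Fintype.card Ω) := fun l => emb (Sum.inl (Sum.inl (Sum.inl l)))
  let b : Fin (2 * m * δ) → Fin n ⊕ Fin (Fintype.card Ω) := fun l => emb (Sum.inl (Sum.inl (Sum.inr l)))
  let p : Fin (2 * m) → Fin n ⊕ Fin (Fintype.card Ω) := fun t => emb (Sum.inl (Sum.inr (Sum.inl t)))
  let ws : Fin t₀ → Fin n ⊕ Fin (Fintype.card Ω) := fun j => emb (Sum.inl (Sum.inr (Sum.inr j)))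
  let Ul : Fin (3 * (2 * m * δ)) → Fin n ⊕ Fin (Fintype.card Ω) :=
    fun l => emb (Sum.inr (Sum.inl (Sum.inl (Sum.inl l))))
  let Vl : Fin (3 * (2 * m * δ)) → Fin n ⊕ Fin (Fintype.card Ω) :=
    fun l => emb (Sum.inr (Sum.inl (Sum.inl (Sum.inr l))))
  let wsq : Fin (2 * m * δ) → Fin (3 * (2 * m * δ)) → Fin n ⊕ Fin (Fintype.card Ω) :=
    fun i l => emb (Sum.inr (Sum.inl (Sum.inr (Sum.inl (i, l)))))
  let zsq : Fin (2 * m * δ) → Fin n ⊕ Fin (Fintype.card Ω) :=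
    fun i => emb (Sum.inr (Sum.inl (Sum.inr (Sum.inr i))))
  let μ₁ : Fin n ⊕ Fin (Fintype.card Ω) := emb (Sum.inr (Sum.inr (Sum.inl true)))
  let μ₂ : Fin n ⊕ Fin (Fintype.card Ω) := emb (Sum.inr (Sum.inr (Sum.inl false)))
  let dflt : Fin n ⊕ Fin (Fintype.card Ω) := emb (Sum.inr (Sum.inr (Sum.inr ())))
  -- the two layouts the bricks ask for
  have hx : Function.Injective x := fun t t' h =>
    Fin.castLE_injective h2m (Sum.inl_injective h)
  have lay : CircLayout x a b p ws := by
    refine ⟨?_⟩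
    -- `Sum.elim (Sum.elim x (Sum.elim a b)) (Sum.elim p ws)` = `x` on the left, `emb ∘ ψ` elsewhere
    let ψ : (Fin (2 * m * δ) ⊕ Fin (2 * m * δ)) ⊕ (Fin (2 * m) ⊕ Fin t₀) → Ω := fun o => Sum.inl o
    have hψ : Function.Injective ψ := fun o o' h => Sum.inl_injective h
    have key : Sum.elim (Sum.elim x (Sum.elim a b)) (Sum.elim p ws) =
        Sum.elim (Sum.elim x (emb ∘ ψ ∘ Sum.inl)) (emb ∘ ψ ∘ Sum.inr) := by
      funext o; rcases o with (t | (l | l)) | (t | j) <;> rfl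
    rw [key]
    refine Function.Injective.sumElim (Function.Injective.sumElim hx
      (hemb.comp (hψ.comp Sum.inl_injective)) (fun t o h => Sum.inl_ne_inr h))
      (hemb.comp (hψ.comp Sum.inr_injective)) ?_
    rintro (t | o) o' h
    · exact Sum.inl_ne_inr h
    · have := hψ (hemb h); simp at this
  have Dsup : DetSupply a b Ul Vl wsq zsq μ₁ μ₂ := by
    refine ⟨?_⟩
    let ψ : ((Fin (2 * m * δ) ⊕ Fin (2 * m * δ)) ⊕ (Fin (3 * (2 * m * δ)) ⊕ Fin (3 * (2 * m * δ)))) ⊕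
        (((Fin (2 * m * δ) × Fin (3 * (2 * m * δ))) ⊕ Fin (2 * m * δ)) ⊕ Bool) → Ω :=
      Sum.elim (Sum.elim (fun ab => Sum.inl (Sum.inl ab)) (fun uv => Sum.inr (Sum.inl (Sum.inl uv))))
        (Sum.elim (fun wz => Sum.inr (Sum.inl (Sum.inr wz))) (fun bb => Sum.inr (Sum.inr (Sum.inl bb))))
    have hψ : Function.Injective ψ := by
      rintro ((ab | uv) | (wz | bb)) ((ab' | uv') | (wz' | bb')) h <;>
        simp only [ψ, Ω, Sum.elim_inl, Sum.elim_inr, Sum.inl.injEq, Sum.inr.injEq,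
          reduceCtorEq] at h <;> rw [h]
    have key : Sum.elim (Sum.elim (Sum.elim a b) (Sum.elim Ul Vl))
        (Sum.elim (Sum.elim (fun q : Fin (2 * m * δ) × Fin (3 * (2 * m * δ)) => wsq q.1 q.2) zsq)
          (fun bb : Bool => if bb then μ₁ else μ₂)) = emb ∘ ψ := by
      funext o
      rcases o with ((l | l) | (l | l)) | ((⟨i, l⟩ | i) | bb)
      all_goals first | rfl | (cases bb <;> rfl)
    rw [key]
    exact hemb.comp hψ
  -- (5) the explicit encoder circuit of the padded `M̃` (Lemma 3.5)
  obtain ⟨C, hC2, hCcomp, hCsz, hCproj⟩ :=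
    CT23Encoder.exists_encoderCircuit lay dflt
      (natBits _ (prefixLen G' (blockEnum (2 * m) δ) hdep) (Nat.lt_of_succ_le hK))
      α (2 * m * (2 ^ δ - 1) * d + 1) G' Qs hQs2 hQsc hQss hQsp
  have hdetE := CT23Encoder.det_matOf_encoderSkeleton_prefix lay.toEncLayout G' hdep α
    (2 * m * (2 ^ δ - 1) * d + 1)
  -- the encoder polynomial mentions only `x`, `a`, `b`
  have hEvars : ∀ v ∈ (encoderSkeleton x a b
      (natBits _ (prefixLen G' (blockEnum (2 * m) δ) hdep) (Nat.lt_of_succ_le hK))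
      (fun t => gKron a α (2 * m * (2 ^ δ - 1) * d + 1) (G' t))).vars,
      v ∈ Set.range x ∪ Set.range a ∪ Set.range b := fun v hv =>
    vars_encoderSkeleton_gKron_subset x a b _ α _ G' (Finset.mem_coe.2 hv)
  have hEU : ∀ v ∈ (encoderSkeleton x a b
      (natBits _ (prefixLen G' (blockEnum (2 * m) δ) hdep) (Nat.lt_of_succ_le hK))
      (fun t => gKron a α (2 * m * (2 ^ δ - 1) * d + 1) (G' t))).vars,
      (∀ l, Ul l ≠ v) ∧ ∀ l, Vl l ≠ v := by
    intro v hv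
    rcases hEvars v hv with (⟨t, rfl⟩ | ⟨l', rfl⟩) | ⟨l', rfl⟩
    · exact ⟨fun l h => Sum.inr_ne_inl h, fun l h => Sum.inr_ne_inl h⟩
    · exact ⟨fun l h => by have := hemb h; simp [Ω] at this, fun l h => by have := hemb h; simp [Ω] at this⟩
    · exact ⟨fun l h => by have := hemb h; simp [Ω] at this, fun l h => by have := hemb h; simp [Ω] at this⟩
  have hEw : ∀ i l, wsq i l ∉ (encoderSkeleton x a b
      (natBits _ (prefixLen G' (blockEnum (2 * m) δ) hdep) (Nat.lt_of_succ_le hK))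
      (fun t => gKron a α (2 * m * (2 ^ δ - 1) * d + 1) (G' t))).vars := by
    intro i l hv
    rcases hEvars _ hv with (⟨t, h⟩ | ⟨l', h⟩) | ⟨l', h⟩
    · exact Sum.inl_ne_inr h
    · have := hemb h; simp [Ω] at this
    · have := hemb h; simp [Ω] at this
  have hEz : ∀ i, zsq i ∉ (encoderSkeleton x a b
      (natBits _ (prefixLen G' (blockEnum (2 * m) δ) hdep) (Nat.lt_of_succ_le hK))
      (fun t => gKron a α (2 * m * (2 ^ δ - 1) * d + 1) (G' t))).vars := by
    intro i hv
    rcases hEvars _ hv with (⟨t, h⟩ | ⟨l', h⟩) | ⟨l', h⟩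
    · exact Sum.inl_ne_inr h
    · have := hemb h; simp [Ω] at this
    · have := hemb h; simp [Ω] at this
  have hCpv : ∀ i ∈ C.projVars, (∀ l, a l ≠ i) ∧ (∀ l, b l ≠ i) ∧ (∀ l, Ul l ≠ i) ∧ (∀ l, Vl l ≠ i) ∧
      (∀ j l, wsq j l ≠ i) ∧ ∀ j, zsq j ≠ i := by
    intro i hi
    obtain ⟨j, rfl⟩ := hCproj hi
    refine ⟨fun l h => ?_, fun l h => ?_, fun l h => ?_, fun l h => ?_, fun j' l h => ?_, fun j' h => ?_⟩ <;>
      · have := hemb h; simp [Ω] at this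
  -- (6) Prop. 2.29: the determinant of the encoded matrix
  obtain ⟨Qd, hQd2, -, hQdcomp, hQdsz, -⟩ :=
    exists_projCircuit_det_matOf_general (Nat.mul_pos (by omega) hδpos) le_rfl Dsup hEU hEw hEz
      hC2 hCcomp hCpv
  -- (7) conclusion
  refine ⟨Fintype.card Ω, rename (Fin.castLE h2m) A, Qd, ?_, ?_, ?_, hQd2, ?_, ?_, ?_⟩
  · exact fun h => hA0 (rename_injective _ (Fin.castLE_injective h2m) (by rw [h, map_zero]))
  · intro j
    by_cases hj : j ∈ Set.range (Fin.castLE h2m)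
    · obtain ⟨t, rfl⟩ := hj
      rw [degreeOf_rename_of_injective (Fin.castLE_injective h2m)]
      have := hAdeg t
      have h3 : 2 ^ δ ≤ 3 * m * d := hδle
      omega
    · rw [degreeOf_eq_sup, support_rename_of_injective (Fin.castLE_injective h2m)]
      refine (Finset.sup_le fun e he => ?_).trans (Nat.zero_le _)
      obtain ⟨e', -, rfl⟩ := Finset.mem_image.mp he
      rw [Finsupp.mapDomain_notin_range _ _ hj]
  · rw [aeval_rename]
    exact hAG
  · change Qd.eval = rename Sum.inl (rename (Fin.castLE h2m) A)
    rw [hQdcomp, hdetE, rename_rename]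
    rfl
  · have hcard : Fintype.card Ω = 2 * m * δ + 2 * m * δ + (2 * m + t₀) +
        (3 * (2 * m * δ) + 3 * (2 * m * δ) + (2 * m * δ * (3 * (2 * m * δ)) + 2 * m * δ) + (2 + 1)) := by
      simp only [Ω, Fintype.card_sum, Fintype.card_prod, Fintype.card_fin, Fintype.card_bool,
        Fintype.card_unit]
    rw [hcard]
    exact workspace_le hm hd hs hδle (ht₀.trans (by omega))
  · refine hQdsz.trans ((Nat.add_le_add_right (Nat.mul_le_mul_left 2 hCsz) _).trans ?_)
    exact size_le hm hd hs hδle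

end Literature.Barriers.ValiantsHypothesis

end
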